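import Mathlib.RingTheory.MvPolynomial.Basic
import Mathlib.RingTheory.MvPolynomial.Expand
import Mathlib.RingTheory.Polynomial.Basic
import Mathlib.FieldTheory.Perfect
import Literature.NumberTheory.GaloisCohomology.PBasis
import HarnessLib

/-!
# The variables of a polynomial ring over a perfect ring form a `p`-basis

The basic example of a finite `p`-basis (`IsPBasis`, file `PBasis.lean`): for a perfect ring `k`
of prime characteristic `p` (Frobenius bijective, e.g. a perfect field) and a finite index type
`ι`, the variables `X i` of `MvPolynomial ι k` form a `p`-basis, i.e. every polynomial `f` is
UNIQUELY `f = ∑_α g_α ^ p * X^α` (`α : ι → Fin p`, `X^α = ∏ i, X i ^ α i`),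
`isPBasis_mvPolynomial_X`.

Proof.  SPANNING: a monomial `c X^β` is `(c^{1/p} X^{β / p}) ^ p * X^{β % p}` (coordinatewise
division with remainder of the exponent, `monomial_eq_pow_mul_pMonomial`), i.e. a twisted scalar
multiple of the `p`-monomial `X^{β % p}`, and the span is closed under sums.  INDEPENDENCE: the
coefficient of `X^{p q + α}` in `∑_β g_β ^ p * X^β` is `(coeff q g_α) ^ p`
(`coeff_sum_pow_mul_pMonomial`: `g ^ p = ∑_γ (coeff γ g)^p X^{p γ}` by
`MvPolynomial.map_frobenius_expand`, and `p q + α - β` has a coordinate not divisible by `p` when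
`β ≠ α`), so `∑_β g_β ^ p * X^β = 0` forces `(coeff q g_α) ^ p = 0`, hence `coeff q g_α = 0` by
injectivity of Frobenius on `k`.

This is the polynomial case of: a smooth algebra over a perfect field has, locally, a `p`-basis
(Matsumura, *Commutative Ring Theory*, §26; the programme towards the Cartier isomorphism uses it
through `PBasis.lean`).  Deliberately NOT here: localizations and étale extensions of `p`-bases
(separate files), power series.
-/

noncomputable section

open scoped BigOperators
open MvPolynomial

namespace Literature.NumberTheory.GaloisCohomology

universe u v

section Coeff

variable (p : ℕ) [hp : Fact p.Prime] (k : Type u) [CommRing k] {ι : Type v}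

omit hp in
/-- The `p`-monomial `X^α = ∏ i, X i ^ α i` of the variables of `MvPolynomial ι k` is the monomial
with exponent vector `α` and coefficient `1`. [folklore] -/
theorem pMonomial_X_eq_monomial [Fintype ι] (α : ι → Fin p) :
    pMonomial p (fun i : ι => (X i : MvPolynomial ι k)) α =
      monomial (Finsupp.equivFunOnFinite.symm fun i => (α i : ℕ)) 1 := by
  unfold pMonomial
  rw [monomial_eq, C_1, one_mul, Finsupp.prod_pow]
  rfl

variable [CharP k p]

/-- In characteristic `p`: `coeff (p • q) (f ^ p) = (coeff q f) ^ p` for a multivariate polynomial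
`f` (`f ^ p = ∑_γ (coeff γ f) ^ p X^{p γ}`). [folklore] -/
theorem coeff_smul_pow_char (f : MvPolynomial ι k) (q : ι →₀ ℕ) :
    coeff (p • q) (f ^ p) = coeff q f ^ p := by
  rw [← map_frobenius_expand p (f := f), coeff_map, coeff_expand_smul p hp.out.ne_zero,
    frobenius_def]

/-- In characteristic `p`: `coeff m (f ^ p) = 0` when some exponent `m i` is not divisible by `p`.
[folklore] -/
theorem coeff_pow_char_of_not_dvd (f : MvPolynomial ι k) {m : ι →₀ ℕ} {i : ι} (h : ¬p ∣ m i) :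
    coeff m (f ^ p) = 0 := by
  rw [← map_frobenius_expand p (f := f), coeff_map, coeff_expand_of_not_dvd f h, map_zero]

/-- **Coefficient extraction from a `p`-expansion.**  For `g : (ι → Fin p) → MvPolynomial ι k`,
the coefficient of `X^{p q + α}` in `∑_β g_β ^ p * X^β` is `(coeff q g_α) ^ p`: the term `β = α`
contributes `coeff (p q) (g_α ^ p)`, and for `β ≠ α` the exponent `p q + α - β` has a coordinate
not divisible by `p`. [folklore] -/
theorem coeff_sum_pow_mul_pMonomial [Fintype ι] [DecidableEq ι] (g : (ι → Fin p) → MvPolynomial ι k)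
    (q : ι →₀ ℕ) (α : ι → Fin p) :
    coeff (p • q + Finsupp.equivFunOnFinite.symm fun i => (α i : ℕ))
        (∑ β, g β ^ p * pMonomial p (fun i : ι => (X i : MvPolynomial ι k)) β) =
      coeff q (g α) ^ p := by
  rw [coeff_sum, Finset.sum_eq_single α]
  · rw [pMonomial_X_eq_monomial, coeff_mul_monomial, mul_one, coeff_smul_pow_char]
  · intro β _ hβα
    obtain ⟨i, hi⟩ := Function.ne_iff.1 hβα
    rw [pMonomial_X_eq_monomial, coeff_mul_monomial']
    split_ifs with hle
    · rw [mul_one]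
      refine coeff_pow_char_of_not_dvd p k (g β) (i := i) fun hdvd => hi ?_
      have hle' := hle i
      simp only [Finsupp.coe_tsub, Pi.sub_apply, Finsupp.coe_add, Pi.add_apply, Finsupp.coe_smul,
        Pi.smul_apply, smul_eq_mul, Finsupp.coe_equivFunOnFinite_symm] at hdvd hle'
      obtain ⟨c, hc⟩ := hdvd
      have h1 : p * q i + (α i : ℕ) = p * c + β i := by omega
      have h2 := congrArg (· % p) h1
      simp only [Nat.mul_add_mod, Nat.mod_eq_of_lt (α i).isLt, Nat.mod_eq_of_lt (β i).isLt] at h2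
      exact Fin.ext h2.symm
    · rfl
  · intro h
    exact absurd (Finset.mem_univ α) h

/-- **Division with remainder of a monomial by `p`-th powers.**  Over a perfect ring `k` of
characteristic `p`, `c X^β = (c^{1/p} X^{β / p}) ^ p * X^{β % p}` (coordinatewise quotient and
remainder of the exponent vector; `c^{1/p} = (frobeniusEquiv k p).symm c`). [folklore] -/
theorem monomial_eq_pow_mul_pMonomial [PerfectRing k p] [Fintype ι] (β : ι →₀ ℕ) (c : k) :
    (monomial β c : MvPolynomial ι k) =
      monomial (β.mapRange (· / p) (Nat.zero_div p)) ((frobeniusEquiv k p).symm c) ^ p *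
        pMonomial p (fun i : ι => (X i : MvPolynomial ι k))
          (fun i => ⟨β i % p, Nat.mod_lt _ hp.out.pos⟩) := by
  rw [monomial_pow, frobeniusEquiv_symm_pow_p, pMonomial_X_eq_monomial, monomial_mul, mul_one]
  refine congrArg (fun s => monomial s c) (Finsupp.ext fun i => ?_)
  simp only [Finsupp.coe_add, Pi.add_apply, Finsupp.coe_smul, Pi.smul_apply, smul_eq_mul,
    Finsupp.mapRange_apply, Finsupp.coe_equivFunOnFinite_symm]
  exact (Nat.div_add_mod (β i) p).symm

end Coeff

/-- **The variables of a polynomial ring over a perfect ring of characteristic `p` form a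
`p`-basis.**  For a perfect ring `k` of prime characteristic `p` (e.g. a perfect field:
`PerfectField.toPerfectRing`) and a finite index type `ι`, the family `X : ι → MvPolynomial ι k`
is a `p`-basis (`IsPBasis`): the `p`-monomials `X^α = ∏ i, X i ^ α i`, `α : ι → Fin p`, form a
basis of `MvPolynomial ι k` over itself acting through Frobenius, i.e. every `f` is uniquely
`∑_α g_α ^ p * X^α`. [folklore] -/
theorem isPBasis_mvPolynomial_X (p : ℕ) [hp : Fact p.Prime] (k : Type u) [CommRing k] [CharP k p]
    [PerfectRing k p] (ι : Type v) [Fintype ι] :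
    IsPBasis p (fun i : ι => (X i : MvPolynomial ι k)) where
  linearIndependent := by
    classical
    rw [Fintype.linearIndependent_iff]
    intro g hg α
    have key : ∑ β, g β ^ p * pMonomial p (fun i : ι => (X i : MvPolynomial ι k)) β = 0 := by
      apply (FrobeniusTwist.of p (MvPolynomial ι k)).injective
      rw [map_sum, map_zero, ← hg]
      exact Finset.sum_congr rfl fun β _ =>
        (FrobeniusTwist.smul_of_eq_of_pow_mul p (g β) (pMonomial p _ β)).symm
    ext q
    apply injective_frobenius k p
    rw [frobenius_def, frobenius_def, coeff_zero, zero_pow hp.out.ne_zero,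
      ← coeff_sum_pow_mul_pMonomial p k g q α, key, coeff_zero]
  span_eq_top := by
    rw [eq_top_iff]
    rintro x -
    obtain ⟨f, rfl⟩ := (FrobeniusTwist.of p (MvPolynomial ι k)).surjective x
    induction f using MvPolynomial.induction_on' with
    | monomial β c =>
      rw [monomial_eq_pow_mul_pMonomial p k β c, ← FrobeniusTwist.smul_of_eq_of_pow_mul]
      exact Submodule.smul_mem _ _ (Submodule.subset_span ⟨_, rfl⟩)
    | add f g hf hg =>
      rw [map_add]
      exact Submodule.add_mem _ hf hg

/-- **The variables of a polynomial ring over a perfect field of characteristic `p` form a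
`p`-basis** (the case of `isPBasis_mvPolynomial_X` the Cartier-isomorphism programme uses; the
`PerfectRing` instance is `PerfectField.toPerfectRing`). [folklore] -/
theorem isPBasis_mvPolynomial_X_of_perfectField (p : ℕ) [Fact p.Prime] (k : Type u) [Field k]
    [CharP k p] [PerfectField k] (ι : Type v) [Fintype ι] :
    IsPBasis p (fun i : ι => (X i : MvPolynomial ι k)) :=
  isPBasis_mvPolynomial_X p k ι

end Literature.NumberTheory.GaloisCohomology

end
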